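import Summits.HubbardSuperconductivity.HubbardSuperconductivity.Theorems.AnisotropyChordTransferFibre3TwoHoleBSRedSkeleton
import Summits.HubbardSuperconductivity.HubbardSuperconductivity.Theorems.AnisotropyChordTransferFibre3TwoHoleBSNear

/-!
# Route `AnisotropyChord` / H0 rotor rung: the point families and BOUNDARY-MASS identities of the overlapping-cross classes `(1,0)`, `(1,1)`, `(2,0)`

Twenty-eighth file of the `TwoHoleBS` (PROP BS) chain; sixth stone of the reduced-slot treatment (memo HOLE2NEAR-LEAN-g3 §6).
`…TwoHoleBSPointSkeleton.dualCert_of_redSkeleton` needs, per class, a point family `Fin 2 ⊕ Fin n → Tor L` (the pair at `inl`, the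
DISTINCT live boundary points at `inr`) with weights `N` and the identity `nbr φ z₁ + nbr φ z₂ = Σ_j N_j‖φ(live_j)‖²` for `φ` vanishing on
the pair (dead neighbours drop, coincident neighbours add up).  Here for the three classes (same point order as `ptsL_<d>` of
`…TwoHoleBSCertCheckK`):
* `famK_1_0`, `wK_1_0`, ★ `nbr_fam_1_0` (`n = 6`, all weights `1`; the neighbours `z + eₓ = z₂`, `z₂ − eₓ = z₁` are dead);
* `famK_1_1`, `wK_1_1`, ★ `nbr_fam_1_1` (`n = 6`, weights `(2,2,1,1,1,1)`: `z + eₓ` and `z + e_y` are neighbours of both holes);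
* `famK_2_0`, `wK_2_0`, ★ `nbr_fam_2_0` (`n = 7`, weights `(2,1,…,1)`: `z + eₓ` is a neighbour of both holes);
* `famK_<d>_inl` (the pair sits at the `inl` indices).
Prover seat `hubbard-h0-rotor-p2` g3; helper for stmt-HubbardSuperconductivity-19089 (`--supports`, helper class).
WHAT THIS IS NOT: nothing here proves superconductivity in the Hubbard model; the rotor TARGET as originally worded stays
FALSE (g15 verdict).  Torus bookkeeping only.  Mathlib + tree imports only; no sorry, no axioms.
-/

set_option linter.dupNamespace false
set_option autoImplicit false

noncomputable section

open scoped BigOperators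

namespace Summit.HubbardSuperconductivity.HubbardSuperconductivity.Theorems.AnisotropyChord.Transfer.Fibre3

namespace TwoHoleBS

variable (L : ℕ) [NeZero L]

omit [NeZero L] in
/-- `castPt (1,0) = eₓ`. [folklore] -/
theorem castPt_one_zero : castPt L (1, 0) = ex L := by ext <;> simp [castPt, ex]

omit [NeZero L] in
/-- `castPt (0,1) = e_y`. [folklore] -/
theorem castPt_zero_one : castPt L (0, 1) = ey L := by ext <;> simp [castPt, ey]

omit [NeZero L] in
/-- the boundary mass of one hole in `castPt` form. [folklore] -/
theorem nbr_eq_castPt (φ : Tor L → ℂ) (z : Tor L) :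
    nbr L φ z = ‖φ (z + castPt L (1, 0))‖ ^ 2 + ‖φ (z + castPt L (-1, 0))‖ ^ 2 + ‖φ (z + castPt L (0, 1))‖ ^ 2
      + ‖φ (z + castPt L (0, -1))‖ ^ 2 := by
  unfold nbr
  rw [nnList_map_sum]
  have e1 : ex L = castPt L (1, 0) := (castPt_one_zero L).symm
  have e2 : -ex L = castPt L (-1, 0) := by rw [e1]; ext <;> simp [castPt]
  have e3 : ey L = castPt L (0, 1) := (castPt_zero_one L).symm
  have e4 : -ey L = castPt L (0, -1) := by rw [e3]; ext <;> simp [castPt]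
  rw [e2, e4, e1, e3]

omit [NeZero L] in
/-- shifting a shifted point: `z + castPt d + castPt e = z + castPt (d + e)`. [folklore] -/
theorem add_castPt_add (z : Tor L) (d e : ℤ × ℤ) : z + castPt L d + castPt L e = z + castPt L (d + e) := by
  rw [castPt_add, add_assoc]

/-! ## Class `(1,0)` -/

/-- the point family of the class `(1,0)`: centres `z, z + (1,0)`; live points `z + {(−1,0),(0,1),(0,−1),(2,0),(1,1),(1,−1)}`. [folklore] -/
def famK_1_0 (z : Tor L) : Fin 2 ⊕ Fin 6 → Tor L :=
  Sum.elim ![z, z + castPt L (1, 0)]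
    ![z + castPt L (-1, 0), z + castPt L (0, 1), z + castPt L (0, -1), z + castPt L (2, 0), z + castPt L (1, 1),
      z + castPt L (1, -1)]

/-- weights of the class `(1,0)` (all `1`). [folklore] -/
def wK_1_0 : Fin 6 → ℝ := fun _ => 1

omit [NeZero L] in
/-- the pair sits at the `inl` indices. [folklore] -/
theorem famK_1_0_inl (z : Tor L) : famK_1_0 L z (Sum.inl 0) = z ∧ famK_1_0 L z (Sum.inl 1) = z + castPt L (1, 0) := by
  simp [famK_1_0]

omit [NeZero L] in
/-- ★ boundary mass of the class `(1,0)`. [folklore] -/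
theorem nbr_fam_1_0 (z : Tor L) (φ : Tor L → ℂ) (h1 : φ z = 0) (h2 : φ (z + castPt L (1, 0)) = 0) :
    nbr L φ z + nbr L φ (z + castPt L (1, 0))
      = ∑ k, Sum.elim (fun _ => (0 : ℝ)) wK_1_0 k * ‖φ (famK_1_0 L z k)‖ ^ 2 := by
  rw [nbr_eq_castPt, nbr_eq_castPt]
  simp only [add_castPt_add]
  norm_num
  have hz : z + castPt L (0, 0) = z := by
    have : castPt L (0, 0) = 0 := by ext <;> simp [castPt]
    rw [this, add_zero]
  rw [hz, h1, h2]
  simp [famK_1_0, wK_1_0, Fin.sum_univ_succ]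
  ring

/-! ## Class `(1,1)` -/

/-- the point family of the class `(1,1)`: live points `z + {(1,0),(0,1),(−1,0),(0,−1),(2,1),(1,2)}` (the first two adjacent to both holes). [folklore] -/
def famK_1_1 (z : Tor L) : Fin 2 ⊕ Fin 6 → Tor L :=
  Sum.elim ![z, z + castPt L (1, 1)]
    ![z + castPt L (1, 0), z + castPt L (0, 1), z + castPt L (-1, 0), z + castPt L (0, -1), z + castPt L (2, 1),
      z + castPt L (1, 2)]

/-- weights of the class `(1,1)`. [folklore] -/
def wK_1_1 : Fin 6 → ℝ := ![2, 2, 1, 1, 1, 1]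

omit [NeZero L] in
/-- the pair sits at the `inl` indices. [folklore] -/
theorem famK_1_1_inl (z : Tor L) : famK_1_1 L z (Sum.inl 0) = z ∧ famK_1_1 L z (Sum.inl 1) = z + castPt L (1, 1) := by
  simp [famK_1_1]

omit [NeZero L] in
/-- ★ boundary mass of the class `(1,1)`. [folklore] -/
theorem nbr_fam_1_1 (z : Tor L) (φ : Tor L → ℂ) :
    nbr L φ z + nbr L φ (z + castPt L (1, 1))
      = ∑ k, Sum.elim (fun _ => (0 : ℝ)) wK_1_1 k * ‖φ (famK_1_1 L z k)‖ ^ 2 := by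
  rw [nbr_eq_castPt, nbr_eq_castPt]
  simp only [add_castPt_add]
  norm_num
  simp [famK_1_1, wK_1_1, Fin.sum_univ_succ]
  ring

/-! ## Class `(2,0)` -/

/-- the point family of the class `(2,0)`: live points `z + {(1,0),(−1,0),(0,1),(0,−1),(3,0),(2,1),(2,−1)}` (the first adjacent to both holes). [folklore] -/
def famK_2_0 (z : Tor L) : Fin 2 ⊕ Fin 7 → Tor L :=
  Sum.elim ![z, z + castPt L (2, 0)]
    ![z + castPt L (1, 0), z + castPt L (-1, 0), z + castPt L (0, 1), z + castPt L (0, -1), z + castPt L (3, 0),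
      z + castPt L (2, 1), z + castPt L (2, -1)]

/-- weights of the class `(2,0)`. [folklore] -/
def wK_2_0 : Fin 7 → ℝ := ![2, 1, 1, 1, 1, 1, 1]

omit [NeZero L] in
/-- the pair sits at the `inl` indices. [folklore] -/
theorem famK_2_0_inl (z : Tor L) : famK_2_0 L z (Sum.inl 0) = z ∧ famK_2_0 L z (Sum.inl 1) = z + castPt L (2, 0) := by
  simp [famK_2_0]

omit [NeZero L] in
/-- ★ boundary mass of the class `(2,0)`. [folklore] -/
theorem nbr_fam_2_0 (z : Tor L) (φ : Tor L → ℂ) :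
    nbr L φ z + nbr L φ (z + castPt L (2, 0))
      = ∑ k, Sum.elim (fun _ => (0 : ℝ)) wK_2_0 k * ‖φ (famK_2_0 L z k)‖ ^ 2 := by
  rw [nbr_eq_castPt, nbr_eq_castPt]
  simp only [add_castPt_add]
  norm_num
  simp [famK_2_0, wK_2_0, Fin.sum_univ_succ]
  ring

end TwoHoleBS

end Summit.HubbardSuperconductivity.HubbardSuperconductivity.Theorems.AnisotropyChord.Transfer.Fibre3

end
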